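import Literature.NumberTheory.QuadraticFields.FormGenus
import Literature.NumberTheory.EllipticCurves.HeegnerPointsShimuraReciprocity
import HarnessLib

set_option linter.dupNamespace false -- namespace `…BirchSwinnertonDyer.BirchSwinnertonDyer…` is the cell's (D-0017 nested layout)
set_option autoImplicit false

/-!
# GENUS-SQUARES-ODD: for `d = −4q`, `q ≡ 5 (mod 8)` prime, the squares of the class group `C(−4q)` form a
# subgroup of ODD order (`C² ∩ C[2] = 1`, «Rédei `4`-rank zero», `h(−4q) ≡ 2 (mod 4)`)

Cell `bsd-goldfeld`, seat `bsd-goldfeld-s1p-c3` (prover, gen 16); planner g31 ruling (cxli)(E), ORDER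
`GENUS-SQUARES-ODD`. Support for item `stmt-BirchSwinnertonDyer-20044` (K12₂″,
`Summit.BirchSwinnertonDyer.BirchSwinnertonDyer.Theses.GoldfeldAllTwistsTwoConverse.RankOneTwoConverseCMSevenAdditiveTwo`)
through the half-trace argument on the prime family F1 = `49a1^{(−q)}`, `q ≡ 5 (mod 8)`: this file DISCHARGES BY
NAME the residual binder (b₂) of seat c201's FILE 2 — "`#Cl(𝒪_{−4q})²` is odd" — which is what turns the term
`#S • φ(0)` of the summed conjugation law (`conjPoint_sum_φ_heegnerTau_sqCoset`, `S = Cl²·γ₀`, `γ₀ = 1`,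
`#S = #Cl²` odd) into `φ(0) = T` in the half-trace relation `z + z̄ = T`. Theses-free, fact-free: Gauss's genus
theory for ONE discriminant, on the SAME carrier as `heegnerFormClass` / ty's FILE D — the class group
`ClassGroup (OrderCl.QO Δ)` of the order `𝒪_D`, `Δ.D = −4q` (NOT `ClassGroup (𝓞 K)`).

HONEST FRAMING: nothing new in print terms (Gauss, *Disquisitiones* §§257–258, 286; Cox §3.B); proves nothing
about BSD; closes no item (20044 K12₂″ unchanged); a binder discharge for the named input
`X049GenusHalfTraceFiveModEight` of a density-zero prime family.

## The argument (road G of the ORDER: the assigned character `δ = χ₋₄` by hand)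

`D = −4q`, `q ≡ 5 (mod 8)` prime; `C = C(𝒪_D) ≅ C(D)` (Cox Thm. 7.7), `μ(D) = 2` assigned characters
(`χ_q`, `δ`; Cox Prop. 3.11 with `n = q ≡ 1 (mod 4)`), so `#C[2] = 2^{μ−1} = 2` (tree
`natCard_sq_eq_one_classGroup_QO`). The ambiguous reduced form `a = (2, 2, (q+1)/2)` (discriminant
`4 − 4(q+1) = −4q`; primitive as `(q+1)/2` is odd; reduced as `2 ≤ (q+1)/2`) has `[a]² = 1` (Cox Lemma 3.10:
`b = a`; tree `classOf'_sq_eq_one_iff`), so `C[2] = {1, [a]}`. The form `a` represents `a(0,1) = (q+1)/2`, a unit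
modulo `4q`; if `[a]` were in the principal genus (`ker Φ`, `Φ = genusHom Δ` Cox's genus homomorphism (3.12),
tree `mem_ker_genusHom_iff`), `(q+1)/2` would be a value of the principal form `x² + qy²` modulo `4q`
(`mem_principalValues_iff`), hence modulo `4`: `x² + y² ≡ (q+1)/2 ≡ 3 (mod 4)` — impossible. So
`[a] ∉ ker Φ ⊇ C²` (`range_pow_two_le_ker_genusHom`): `[a]` is not a square, i.e. **`C² ∩ C[2] = 1`** (T1).
By Cauchy's theorem the subgroup `C²` (no element of order `2`) has odd order (T2), and
`#C² · 2 = [C : C²] · #C² / … = h(−4q)` with `[C : C²] = 2^{μ−1} = 2` (`index_range_sq_classGroup_QO`), so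
`h(−4q) ≡ 2 (mod 4)`. §3 restates T1/T2 over the field-indexed carrier `ClassGroup (OrderCl.QO hK.negDiscr)`,
`hK : IsImaginaryQuadratic K`, `d_K = −4q` (`IsImaginaryQuadratic.negDiscr_D`), the consumer's shape.

References: [Cox2013] D. A. Cox, *Primes of the form x² + ny²*, 2nd ed. (2013), §2.A (2.4), Thm. 2.8; §2.C
Lemma 2.24; §3.A Lemma 3.10, Prop. 3.11; §3.B (3.12), Lemma 3.13, Thm. 3.15; §7.B Thm. 7.7.
-/

noncomputable section

namespace Summit.BirchSwinnertonDyer.BirchSwinnertonDyer.Theorems.GoldfeldGoodTwists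

open Literature.Computability.Cryptography.Hallgren2005
open Literature.Computability.Cryptography.Hallgren2005.OrderCl
open Literature.NumberTheory.QuadraticFields.Quadratic
open Literature.NumberTheory.QuadraticFields.BinaryQuadraticForm (assignedCharCount classNumber
  assignedCharCount_neg_four_mul_of_mod_four_eq_one)
open Literature.NumberTheory.ComplexMultiplication.CMTypeLattice (finite_classGroup_QO_of_emod_four
  natCard_classGroup_QO_of_emod_four)
open Literature.NumberTheory.EllipticCurves (IsImaginaryQuadratic)

/-! ## §0 Arithmetic of `q ≡ 5 (mod 8)` and of `D = −4q` -/

section Arith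

variable {q : ℕ}

/-- `(q+1)/2` as an integer is the natural number `(q+1)/2` (`q` odd). [folklore] -/
theorem half_succ_int_eq (hq8 : q % 8 = 5) : ((q : ℤ) + 1) / 2 = (((q + 1) / 2 : ℕ) : ℤ) := by
  omega

/-- For `q ≡ 5 (mod 8)`: `(q+1)/2 ≡ 3 (mod 4)`, in particular it is odd. [folklore] -/
theorem half_succ_mod_four (hq8 : q % 8 = 5) : (q + 1) / 2 % 4 = 3 := by
  omega

/-- For `q ≡ 5 (mod 8)`: `(q+1)/2` is odd. [folklore] -/
theorem odd_half_succ (hq8 : q % 8 = 5) : Odd ((q + 1) / 2) :=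
  Nat.odd_iff.mpr (by omega)

/-- For `q ≡ 5 (mod 8)` prime, `(q+1)/2` is prime to `4q` (odd, and `0 < (q+1)/2 < q`). [folklore] -/
theorem coprime_half_succ_four_mul (hq : q.Prime) (hq8 : q % 8 = 5) : Nat.Coprime ((q + 1) / 2) (4 * q) := by
  refine Nat.Coprime.mul_right ?_ ?_
  · have h2 : Nat.Coprime ((q + 1) / 2) 2 := Nat.coprime_two_right.mpr (odd_half_succ hq8)
    simpa using h2.pow_right 2
  · refine Nat.Coprime.symm ((Nat.Prime.coprime_iff_not_dvd hq).mpr fun h ↦ ?_)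
    have h1 : 0 < (q + 1) / 2 := by omega
    have h3 := Nat.le_of_dvd h1 h
    omega

end Arith

/-! ## §1 The ambiguous form `a = (2, 2, (q+1)/2)` of discriminant `−4q`: `[a]² = 1`, `[a] ∉ ker Φ`, `[a] ∉ C²` -/

section Form

variable (Δ : NegDiscr) {q : ℕ}

/-- `|−4q| = 4q` for the bundled discriminant. [folklore] -/
theorem natAbs_D_eq (hΔ : Δ.D = -(4 * (q : ℤ))) : Δ.D.natAbs = 4 * q := by
  rw [hΔ, Int.natAbs_neg]
  rfl

/-- `−4q ≡ 0 (mod 4)`. [folklore] -/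
theorem D_emod_four (hΔ : Δ.D = -(4 * (q : ℤ))) : Δ.D % 4 = 0 := by
  rw [hΔ]; omega

/-- **`a = (2, 2, (q+1)/2)` is a primitive positive definite form of discriminant `−4q`** (`q ≡ 5 (mod 8)`:
`4 − 4(q+1) = −4q`, `gcd(2, 2, (q+1)/2) = 1` as `(q+1)/2` is odd). [cite: Cox2013, §2.A (primitive positive definite forms)] -/
theorem isPosPrim_ambiguousForm (hq8 : q % 8 = 5) (hΔ : Δ.D = -(4 * (q : ℤ))) :
    (⟨2, 2, ((q : ℤ) + 1) / 2⟩ : BinQF).IsPosPrim Δ.D := by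
  refine ⟨?_, by norm_num, ?_⟩
  · simp only [BinQF.disc, hΔ]
    omega
  · show Nat.gcd (Nat.gcd (2 : ℤ).natAbs (2 : ℤ).natAbs) (((q : ℤ) + 1) / 2).natAbs = 1
    rw [half_succ_int_eq hq8, Int.natAbs_natCast]
    exact Nat.coprime_two_left.mpr (odd_half_succ hq8)

/-- **`a = (2, 2, (q+1)/2)` is reduced** (`|b| = a = 2 ≤ c = (q+1)/2` for `q ≥ 3`, and `b ≥ 0`).
[cite: Cox2013, §2.A (2.4) (reduced forms)] -/
theorem isReduced_ambiguousForm (hq8 : q % 8 = 5) :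
    (⟨2, 2, ((q : ℤ) + 1) / 2⟩ : BinQF).IsReduced := by
  refine ⟨by norm_num, ?_, fun _ ↦ by norm_num⟩
  show (2 : ℤ) ≤ ((q : ℤ) + 1) / 2
  omega

/-- **`[a]² = 1` in `C(𝒪_{−4q})`**: the reduced form `a = (2, 2, (q+1)/2)` is ambiguous (`b = a`), Cox Lemma 3.10
(tree `classOf'_sq_eq_one_iff`). [cite: Cox2013, §3.A Lemma 3.10] -/
theorem classOf'_ambiguousForm_sq (hq8 : q % 8 = 5) (hΔ : Δ.D = -(4 * (q : ℤ))) :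
    classOf' Δ ⟨2, 2, ((q : ℤ) + 1) / 2⟩ ^ 2 = 1 :=
  (classOf'_sq_eq_one_iff Δ (isPosPrim_ambiguousForm Δ hq8 hΔ) (isReduced_ambiguousForm hq8)).mpr
    (Or.inr (Or.inl rfl))

/-- **`[a]` is NOT in the principal genus: `[a] ∉ ker Φ`** for Cox's genus homomorphism `Φ = genusHom Δ`
(`D = −4q`, `q ≡ 5 (mod 8)` prime). The form `a` represents `a(0,1) = (q+1)/2`, a unit mod `4q`; were `[a]` in the
principal genus, `(q+1)/2` would be represented by the principal form `x² + qy²` modulo `4q` (Cox Lemma 2.24,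
tree `mem_ker_genusHom_iff` / `mem_principalValues_iff`), so `x² + y² ≡ (q+1)/2 ≡ 3 (mod 4)` — impossible.  This
is the value `δ((q+1)/2) = −1` of the assigned character `δ = χ₋₄` (Cox Prop. 3.11 / Thm. 3.15), computed by hand.
[cite: Cox2013, §2.C Lemma 2.24 and §3.B (3.12), Thm. 3.15] -/
theorem classOf'_ambiguousForm_notMem_ker_genusHom (hq : q.Prime) (hq8 : q % 8 = 5)
    (hΔ : Δ.D = -(4 * (q : ℤ))) :
    classOf' Δ ⟨2, 2, ((q : ℤ) + 1) / 2⟩ ∉ (genusHom Δ).ker := by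
  intro hker
  have hD0 : Δ.D ≠ 0 := Δ.neg.ne
  have hn : Δ.D.natAbs = 4 * q := natAbs_D_eq Δ hΔ
  -- the unit `u = [(q+1)/2] ∈ (ℤ/4qℤ)*`
  have hcop : Nat.Coprime ((q + 1) / 2) Δ.D.natAbs := by rw [hn]; exact coprime_half_succ_four_mul hq hq8
  set u : (ZMod Δ.D.natAbs)ˣ := ZMod.unitOfCoprime ((q + 1) / 2) hcop with hu
  have hcoe : (u : ZMod Δ.D.natAbs) = (((q + 1) / 2 : ℕ) : ZMod Δ.D.natAbs) := ZMod.coe_unitOfCoprime _ hcop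
  -- `u` is a value of `a`: `a(0, 1) = (q+1)/2`
  have hval : u ∈ BinQF.valueSet ⟨2, 2, ((q : ℤ) + 1) / 2⟩ Δ.D := by
    refine (BinQF.mem_valueSet_iff).mpr ⟨0, 1, ?_⟩
    rw [hcoe, show BinQF.eval ⟨2, 2, ((q : ℤ) + 1) / 2⟩ 0 1 = ((q : ℤ) + 1) / 2 by simp [BinQF.eval],
      half_succ_int_eq hq8, Int.cast_natCast]
  -- in the principal genus, every value of `a` is a value of the principal form `x² + q y²`
  rw [(mem_ker_genusHom_iff Δ (isPosPrim_ambiguousForm Δ hq8 hΔ))] at hker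
  rw [hker, SetLike.mem_coe, mem_principalValues_iff hD0] at hval
  obtain ⟨x, y, hxy⟩ := hval
  have hone : FormComposition.one Δ.D = ⟨1, 0, (q : ℤ)⟩ := by
    rw [one_eq_of_emod_four_eq_zero (D_emod_four Δ hΔ), hΔ]
    congr 1
    omega
  rw [hone, hcoe, show BinQF.eval ⟨1, 0, (q : ℤ)⟩ x y = x ^ 2 + (q : ℤ) * y ^ 2 by simp [BinQF.eval]] at hxy
  -- reduce modulo `4`
  have h4 : 4 ∣ Δ.D.natAbs := by rw [hn]; exact dvd_mul_right 4 q
  have h := congrArg (ZMod.castHom h4 (ZMod 4)) hxy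
  rw [map_intCast, map_natCast] at h
  push_cast at h
  rw [← ZMod.natCast_mod q 4, ← ZMod.natCast_mod ((q + 1) / 2) 4, half_succ_mod_four hq8,
    show q % 4 = 1 by omega] at h
  norm_num at h
  -- in `ℤ/4ℤ`, `x² + y²` is never `3`
  have key : ∀ X Y : ZMod 4, X ^ 2 + Y ^ 2 ≠ 3 := by decide
  exact key _ _ h

/-- **`[a]` is not a square in `C(𝒪_{−4q})`**: `C² ⊆ ker Φ` ("`H` contains all squares", Cox, proof of Thm. 3.15;
tree `range_pow_two_le_ker_genusHom`) and `[a] ∉ ker Φ`. [cite: Cox2013, §3.B proof of Thm. 3.15 and Exercise 3.12 (b)] -/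
theorem not_isSquare_classOf'_ambiguousForm (hq : q.Prime) (hq8 : q % 8 = 5) (hΔ : Δ.D = -(4 * (q : ℤ))) :
    ¬ IsSquare (classOf' Δ ⟨2, 2, ((q : ℤ) + 1) / 2⟩) := by
  rintro ⟨r, hr⟩
  refine classOf'_ambiguousForm_notMem_ker_genusHom Δ hq hq8 hΔ (range_pow_two_le_ker_genusHom Δ ⟨r, ?_⟩)
  rw [powMonoidHom_apply, hr, sq]

/-- `[a] ≠ 1` (the unit class is a square). [cite: Cox2013, §3.A Lemma 3.10] -/
theorem classOf'_ambiguousForm_ne_one (hq : q.Prime) (hq8 : q % 8 = 5) (hΔ : Δ.D = -(4 * (q : ℤ))) :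
    classOf' Δ ⟨2, 2, ((q : ℤ) + 1) / 2⟩ ≠ 1 := fun h ↦
  not_isSquare_classOf'_ambiguousForm Δ hq hq8 hΔ (h ▸ IsSquare.one)

end Form

/-! ## §2 `C(−4q)`: `#C[2] = 2`, `C[2] = {1, [a]}`, T1 `C² ∩ C[2] = 1`, T2 `#C²` odd, `h(−4q) ≡ 2 (mod 4)` -/

section ClassGroup

variable (Δ : NegDiscr) {q : ℕ}

/-- **`μ(−4q) = 2`** assigned characters (`χ_q` and `δ`: `n = q ≡ 1 (mod 4)`, Cox Prop. 3.11's table).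
[cite: Cox2013, §3.A Prop. 3.11] -/
theorem assignedCharCount_neg_four_mul_prime (hq : q.Prime) (hq8 : q % 8 = 5) (hΔ : Δ.D = -(4 * (q : ℤ))) :
    assignedCharCount Δ.D = 2 := by
  rw [hΔ, ← neg_mul, assignedCharCount_neg_four_mul_of_mod_four_eq_one (by omega), Nat.Prime.primeFactors hq,
    Finset.card_singleton]

/-- **`#C(𝒪_{−4q})[2] = 2`** (Gauss / Cox Prop. 3.11: `2^{μ−1}` with `μ = 2`; tree `natCard_sq_eq_one_classGroup_QO`).
[cite: Cox2013, §3.A Prop. 3.11] -/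
theorem natCard_sq_eq_one_classGroup_QO_neg_four_mul (hq : q.Prime) (hq8 : q % 8 = 5)
    (hΔ : Δ.D = -(4 * (q : ℤ))) :
    Nat.card {c : ClassGroup (QO Δ) // c ^ 2 = 1} = 2 := by
  rw [natCard_sq_eq_one_classGroup_QO Δ (Or.inl (D_emod_four Δ hΔ)), assignedCharCount_neg_four_mul_prime Δ hq hq8 hΔ]
  norm_num

/-- **`C(𝒪_{−4q})[2] = {1, [a]}`**: every class of order `≤ 2` is `1` or the class of `a = (2, 2, (q+1)/2)`
(`#C[2] = 2`, `[a]² = 1`, `[a] ≠ 1`). [cite: Cox2013, §3.A Lemma 3.10 and Prop. 3.11] -/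
theorem eq_one_or_eq_classOf'_ambiguousForm_of_sq_eq_one (hq : q.Prime) (hq8 : q % 8 = 5)
    (hΔ : Δ.D = -(4 * (q : ℤ))) (c : ClassGroup (QO Δ)) (hc : c ^ 2 = 1) :
    c = 1 ∨ c = classOf' Δ ⟨2, 2, ((q : ℤ) + 1) / 2⟩ := by
  classical
  by_contra h
  push Not at h
  obtain ⟨hc1, hca⟩ := h
  have h2 := natCard_sq_eq_one_classGroup_QO_neg_four_mul Δ hq hq8 hΔ
  obtain ⟨y, -, hy⟩ := (Nat.card_eq_two_iff' (⟨1, one_pow 2⟩ : {c : ClassGroup (QO Δ) // c ^ 2 = 1})).mp h2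
  have ha : (⟨classOf' Δ ⟨2, 2, ((q : ℤ) + 1) / 2⟩, classOf'_ambiguousForm_sq Δ hq8 hΔ⟩ :
      {c : ClassGroup (QO Δ) // c ^ 2 = 1}) = y :=
    hy _ fun e ↦ classOf'_ambiguousForm_ne_one Δ hq hq8 hΔ (congrArg Subtype.val e)
  have hc' : (⟨c, hc⟩ : {c : ClassGroup (QO Δ) // c ^ 2 = 1}) = y :=
    hy _ fun e ↦ hc1 (congrArg Subtype.val e)
  exact hca (congrArg Subtype.val (hc'.trans ha.symm))

/-- **T1 — `C² ∩ C[2] = 1` IN `C(𝒪_{−4q})`, `q ≡ 5 (mod 8)` prime («Rédei `4`-rank zero»)**: a class which is a square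
and has order `≤ 2` is trivial — `C[2] = {1, [a]}` and `[a]` is not a square (it is not even in the principal genus:
`δ((q+1)/2) = −1`). [cite: Cox2013, §3.B Thm. 3.15 with §3.A Prop. 3.11] -/
theorem eq_one_of_isSquare_of_sq_eq_one_neg_four_mul (Δ : NegDiscr) (q : ℕ) (hq : q.Prime) (hq8 : q % 8 = 5)
    (hΔ : Δ.D = -(4 * (q : ℤ))) (c : ClassGroup (QO Δ)) (hsq : IsSquare c) (hc : c ^ 2 = 1) : c = 1 := by
  rcases eq_one_or_eq_classOf'_ambiguousForm_of_sq_eq_one Δ hq hq8 hΔ c hc with h | h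
  · exact h
  · exact absurd (h ▸ hsq) (not_isSquare_classOf'_ambiguousForm Δ hq hq8 hΔ)

/-- A finite commutative group in which `1` is the only element killed by `2` has odd order (Cauchy). [folklore] -/
theorem odd_natCard_of_forall_sq_eq_one {G : Type*} [CommGroup G] [Finite G] (h : ∀ g : G, g ^ 2 = 1 → g = 1) :
    Odd (Nat.card G) := by
  by_contra hne
  have heven : 2 ∣ Nat.card G := even_iff_two_dvd.mp (Nat.not_odd_iff_even.mp hne)
  haveI : Fact (Nat.Prime 2) := ⟨Nat.prime_two⟩
  obtain ⟨x, hx⟩ := exists_prime_orderOf_dvd_card' 2 heven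
  have hx1 : x = 1 := h x (by rw [← hx]; exact pow_orderOf_eq_one x)
  rw [hx1, orderOf_one] at hx
  exact absurd hx (by decide)

/-- **T2 (subgroup form) — the subgroup `C²` of squares of `C(𝒪_{−4q})` has ODD order**, `q ≡ 5 (mod 8)` prime
(T1 and Cauchy's theorem in the finite group `C²`). [cite: Cox2013, §3.B Thm. 3.15 with §3.A Prop. 3.11] -/
theorem odd_natCard_range_powMonoidHom_two_classGroup_QO_neg_four_mul (Δ : NegDiscr) (q : ℕ) (hq : q.Prime)
    (hq8 : q % 8 = 5) (hΔ : Δ.D = -(4 * (q : ℤ))) :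
    Odd (Nat.card (powMonoidHom 2 : ClassGroup (QO Δ) →* ClassGroup (QO Δ)).range) := by
  haveI := finite_classGroup_QO_of_emod_four Δ (Or.inl (D_emod_four Δ hΔ))
  refine odd_natCard_of_forall_sq_eq_one fun g hg ↦ Subtype.ext ?_
  obtain ⟨r, hr⟩ := g.2
  refine eq_one_of_isSquare_of_sq_eq_one_neg_four_mul Δ q hq hq8 hΔ (g : ClassGroup (QO Δ))
    ⟨r, by rw [← hr, powMonoidHom_apply, sq]⟩ ?_
  rw [← Subgroup.coe_pow, hg, Subgroup.coe_one]

/-- **T2 — the number of SQUARE classes of `C(𝒪_{−4q})` is ODD**, `q ≡ 5 (mod 8)` prime (the set of squares is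
the subgroup `C²`). [cite: Cox2013, §3.B Thm. 3.15 with §3.A Prop. 3.11] -/
theorem odd_natCard_isSquare_classGroup_QO_neg_four_mul (Δ : NegDiscr) (q : ℕ) (hq : q.Prime) (hq8 : q % 8 = 5)
    (hΔ : Δ.D = -(4 * (q : ℤ))) :
    Odd (Nat.card {c : ClassGroup (QO Δ) // IsSquare c}) := by
  have hmem : ∀ c : ClassGroup (QO Δ),
      c ∈ (powMonoidHom 2 : ClassGroup (QO Δ) →* ClassGroup (QO Δ)).range ↔ IsSquare c := fun c ↦ by
    rw [MonoidHom.mem_range, isSquare_iff_exists_sq]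
    exact ⟨fun ⟨x, hx⟩ ↦ ⟨x, hx.symm⟩, fun ⟨x, hx⟩ ↦ ⟨x, hx.symm⟩⟩
  rw [Nat.card_congr (Equiv.subtypeEquivRight fun c ↦ (hmem c).symm)]
  exact odd_natCard_range_powMonoidHom_two_classGroup_QO_neg_four_mul Δ q hq hq8 hΔ

/-- **`#C² · 2 = h(−4q)`**: `[C : C²] = 2^{μ−1} = 2` (Cox, proof of Thm. 3.15; tree `index_range_sq_classGroup_QO`)
and `#C(𝒪_D) = h(D)` (Thm. 7.7 (ii); tree `natCard_classGroup_QO_of_emod_four`). [cite: Cox2013, §3.B proof of Thm. 3.15 and §7.B Thm. 7.7 (ii)] -/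
theorem natCard_range_powMonoidHom_two_mul_two_eq_classNumber (Δ : NegDiscr) (q : ℕ) (hq : q.Prime)
    (hq8 : q % 8 = 5) (hΔ : Δ.D = -(4 * (q : ℤ))) :
    Nat.card (powMonoidHom 2 : ClassGroup (QO Δ) →* ClassGroup (QO Δ)).range * 2 = classNumber Δ.D := by
  have hD4 : Δ.D % 4 = 0 ∨ Δ.D % 4 = 1 := Or.inl (D_emod_four Δ hΔ)
  haveI := finite_classGroup_QO_of_emod_four Δ hD4
  have hidx := index_range_sq_classGroup_QO Δ hD4
  rw [assignedCharCount_neg_four_mul_prime Δ hq hq8 hΔ] at hidx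
  norm_num at hidx
  have hcm := Subgroup.card_mul_index (powMonoidHom 2 : ClassGroup (QO Δ) →* ClassGroup (QO Δ)).range
  rw [hidx] at hcm
  rw [← natCard_classGroup_QO_of_emod_four Δ hD4]
  exact hcm

/-- **`h(−4q) ≡ 2 (mod 4)` for `q ≡ 5 (mod 8)` prime** (`h = 2 · #C²` with `#C²` odd), on the bundled carrier.
[cite: Cox2013, §3.B Thm. 3.15 with §3.A Prop. 3.11] -/
theorem classNumber_neg_four_mul_mod_four (Δ : NegDiscr) (q : ℕ) (hq : q.Prime) (hq8 : q % 8 = 5)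
    (hΔ : Δ.D = -(4 * (q : ℤ))) : classNumber Δ.D % 4 = 2 := by
  obtain ⟨k, hk⟩ := odd_natCard_range_powMonoidHom_two_classGroup_QO_neg_four_mul Δ q hq hq8 hΔ
  rw [← natCard_range_powMonoidHom_two_mul_two_eq_classNumber Δ q hq hq8 hΔ, hk]
  omega

/-- **`h(−4q) ≡ 2 (mod 4)` for every prime `q ≡ 5 (mod 8)`** (Gauss: `μ = 2` genera, and the principal genus
`C²` has odd order). [cite: Cox2013, §3.B Thm. 3.15 with §3.A Prop. 3.11] -/
theorem classNumber_neg_four_mul_prime_mod_four (q : ℕ) (hq : q.Prime) (hq8 : q % 8 = 5) :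
    classNumber (-(4 * (q : ℤ))) % 4 = 2 :=
  classNumber_neg_four_mul_mod_four ⟨-(4 * (q : ℤ)), by have := hq.pos; omega⟩ q hq hq8 rfl

end ClassGroup

/-! ## §3 The consumer's shape: over the carrier `ClassGroup (OrderCl.QO hK.negDiscr)` of an imaginary quadratic
field `K` with `d_K = −4q` -/

section Field

variable {q : ℕ} (K : Type*) [Field K] [NumberField K] (hK : IsImaginaryQuadratic K)

/-- **T1 over the field-indexed carrier**: for `K` imaginary quadratic with `d_K = −4q`, `q ≡ 5 (mod 8)` prime, a
square class of `Cl(𝒪_{d_K}) = ClassGroup (OrderCl.QO hK.negDiscr)` of order `≤ 2` is trivial.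
[cite: Cox2013, §3.B Thm. 3.15 with §3.A Prop. 3.11] -/
theorem eq_one_of_isSquare_of_sq_eq_one_of_discr_eq_neg_four_mul (hq : q.Prime) (hq8 : q % 8 = 5)
    (hdK : NumberField.discr K = -(4 * (q : ℤ))) (c : ClassGroup (QO hK.negDiscr)) (hsq : IsSquare c)
    (hc : c ^ 2 = 1) : c = 1 :=
  eq_one_of_isSquare_of_sq_eq_one_neg_four_mul hK.negDiscr q hq hq8 (by rw [hK.negDiscr_D, hdK]) c hsq hc

/-- **T2 over the field-indexed carrier (subgroup form)**: `#Cl(𝒪_{d_K})²` is odd for `d_K = −4q`,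
`q ≡ 5 (mod 8)` prime. [cite: Cox2013, §3.B Thm. 3.15 with §3.A Prop. 3.11] -/
theorem odd_natCard_range_powMonoidHom_two_of_discr_eq_neg_four_mul (hq : q.Prime) (hq8 : q % 8 = 5)
    (hdK : NumberField.discr K = -(4 * (q : ℤ))) :
    Odd (Nat.card (powMonoidHom 2 : ClassGroup (QO hK.negDiscr) →* ClassGroup (QO hK.negDiscr)).range) :=
  odd_natCard_range_powMonoidHom_two_classGroup_QO_neg_four_mul hK.negDiscr q hq hq8 (by rw [hK.negDiscr_D, hdK])

/-- **T2 over the field-indexed carrier**: the number of square classes of `Cl(𝒪_{d_K})` is odd for `d_K = −4q`,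
`q ≡ 5 (mod 8)` prime. [cite: Cox2013, §3.B Thm. 3.15 with §3.A Prop. 3.11] -/
theorem odd_natCard_isSquare_of_discr_eq_neg_four_mul (hq : q.Prime) (hq8 : q % 8 = 5)
    (hdK : NumberField.discr K = -(4 * (q : ℤ))) :
    Odd (Nat.card {c : ClassGroup (QO hK.negDiscr) // IsSquare c}) :=
  odd_natCard_isSquare_classGroup_QO_neg_four_mul hK.negDiscr q hq hq8 (by rw [hK.negDiscr_D, hdK])

end Field

end Summit.BirchSwinnertonDyer.BirchSwinnertonDyer.Theorems.GoldfeldGoodTwists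

end
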